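import Literature.Probability.LatticeModels.SplitEventFailure
import Literature.Probability.LatticeModels.CurrentCrossingBound
import Literature.Probability.LatticeModels.RandomCurrentsMixingSplitBound
import HarnessLib

/-!
# Lemma 6.7 on a finite graph: the split-event hypothesis of the mixing core through sphere sums (Aizenman–Duminil-Copin 2021)

Topic `Literature/Probability/LatticeModels`. Theorems only; **no named fact is introduced** (D-0026).

M. Aizenman, H. Duminil-Copin, Ann. of Math. **194** (2021) = arXiv:1912.07973, §6.2, **Lemma 6.7** (p. 24)
and its proof (p. 25): "`P^{xu,uy}[G(u₁,…,u_t)ᶜ] ≤ s(n/N)^ε` … Let `G_i` be the event that the current `𝐤_i`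
exists. This event clearly contains the event that `Ann(M,N)` is not crossed by a cluster in `n_i`, and
`Ann(n,m)` is not crossed by a cluster in `n'_i` … We bound the probability of `n_i` crossing `Ann(M,N)` by
… the chain rule for backbones … (6.11) … the remaining current … (6.12) … When dealing with the probability
of `n'_i` crossing `Ann(n,m)`, fix `r = √(nm)` and apply the same reasoning".

This file assembles, on a finite simple graph whose vertex type carries a pseudo-metric with integer
distances to the centre `w` changing by at most one along edges, couplings `K ≥ 0` and an injective bond
ranking, the hypothesis `hG` of `Current.mixingCore` (tree: `RandomCurrentsMixingCore`) for the eight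
switched currents with centre sources `x₁ = x₂ = w`, switch points `v₁, v₂` and far sources `y₁, y₂`, in
terms of CURRENT SUMS OVER SPHERES around `w` (radii `n₀ ≤ r ≤ m₀+1`, `m₀ ≤ M₃ < R ≤ N₄+1`,
`r < dist(w,vᵢ) ≤ M₃`, `dist(w,yᵢ) > N₄`; `E_in` inside `Λ_{n₀}(w)`, `E_out` meeting `Λ_{N₄}(w)ᶜ`):

* `Current.sourcedPair_splitFail_mul_sq_le` — one sourced pair `(∂n = {w,v}, ∂n' = {v,y})`:
  `(∑ w w 𝟙[¬G]) Z[∅]² ≤ (chainOut(v)·Z[∅] + Z[wv]·offOut) Z[vy] + Z[wv] (chainIn(v,y)·Z[∅] + Z[vy]·offIn)`,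
  `chainOut(v) = ∑_{u ∈ S_R} Z[wu]Z[uv]`, `offOut = ∑_{S_{N₄+1}×S_R} Z[sz]²`, `chainIn(v,y) = ∑_{u ∈ S_r} Z[vu]Z[uy]`,
  `offIn = ∑_{S_{n₀}×S_r} Z[sz]²` (`SplitEventFailure` + `CurrentCrossingBound`);
* `Current.sourcelessPair_splitFail_le` — one sourceless pair:
  `∑ w w 𝟙[¬G] ≤ ∑_{S_{N₄+1}×S_{M₃}} Z[sz]² + ∑_{S_{m₀+1}×S_{n₀}} Z[sz]²`;
* `Current.splitFail_hG` — the hypothesis `hG` of `Current.mixingCore`/`mixingCore_prob` for `x₁ = x₂ = w`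
  with `ε_G = 2ε₀ + ε(v₁,y₁) + ε(v₂,y₂)`, the `ε`'s being the above bounds divided by the pair masses
  (`RandomCurrentsMixingSplitBound.tsum_octoWeightSw_mul_splitFailInd_le`).

## References

* M. Aizenman, H. Duminil-Copin, Ann. of Math. 194 (2021), arXiv:1912.07973, §6.2, Lemma 6.7 and its proof
  (pp. 24–25) [AizenmanDuminilCopinAnnals2021].
-/

noncomputable section

open Finset Filter
open scoped symmDiff ENNReal

namespace Literature.Probability.LatticeModels

variable {V : Type*} [Fintype V] [DecidableEq V] {G : SimpleGraph V} [DecidableRel G.Adj]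

namespace Current

variable {K : G.edgeFinset → ℝ} {rk : G.edgeFinset → ℕ} [PseudoMetricSpace V] {w : V}

/-! ### One sourced pair -/

open Classical in
/-- **Lemma 6.7 for one sourced pair, through sphere sums.** For `K ≥ 0`, an injective bond ranking, integer
distances to `w` changing by at most one along edges, radii `n₀ ≤ r ≤ m₀+1`, `n₀ ≤ m₀ ≤ M₃ < R ≤ N₄+1`,
`M₃ ≤ N₄`, a switch point `v` with `r < dist(w,v) ≤ M₃`, a far source `y` with `dist(w,y) > N₄`, `E_in` with
all endpoints in `Λ_{n₀}(w)` and `E_out` meeting `Λ_{N₄}(w)ᶜ`: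
`(∑ 1{∂n={w}Δ{v}}1{∂n'={v}Δ{y}} w w 𝟙[¬G_v(n+n')]) · Z[∅]²`
`≤ ((∑_{u∈S_R} Z[wu]Z[uv]) Z[∅] + Z[wv] ∑_{S_{N₄+1}×S_R} Z[sz]²) Z[vy] + Z[wv] ((∑_{u∈S_r} Z[vu]Z[uy]) Z[∅] + Z[vy] ∑_{S_{n₀}×S_r} Z[sz]²)`.
[cite: AizenmanDuminilCopinAnnals2021, arXiv:1912.07973 §6.2, proof of Lemma 6.7 (p. 25)] -/
theorem sourcedPair_splitFail_mul_sq_le (hK : ∀ e, 0 ≤ K e) (hrk : Function.Injective rk)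
    (hstep : ∀ a b, G.Adj a b → dist w b ≤ dist w a + 1) (hint : ∀ a, ∃ k : ℕ, dist w a = k)
    {n₀ r m₀ M₃ R N₄ : ℕ} (hn₀r : n₀ ≤ r) (hrm : r ≤ m₀ + 1) (h12 : n₀ ≤ m₀) (h23 : m₀ ≤ M₃) (h34 : M₃ ≤ N₄)
    (hMR : M₃ < R) (hRN : R ≤ N₄ + 1) {v y : V} (hrv : (r : ℝ) < dist w v) (hvM : dist w v ≤ M₃)
    (hy : (N₄ : ℝ) < dist w y) {Ein Eout : Finset G.edgeFinset}
    (hEin : ∀ e ∈ Ein, ∀ z ∈ (e : Sym2 V), dist w z ≤ n₀) (hEout : ∀ e ∈ Eout, ∃ z ∈ (e : Sym2 V), (N₄ : ℝ) < dist w z) :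
    (∑' p : Current G × Current G, epairWeight K ({w} ∆ {v}) ({v} ∆ {y}) p *
        (if SplitEvent Ein Eout v y (p.1 + p.2) then 0 else 1)) * ecurrentSum K ∅ ^ 2 ≤
      ((∑ u ∈ univ.filter (fun u => dist w u = R), ecurrentSum K ({w} ∆ {u}) * ecurrentSum K ({u} ∆ {v})) *
            ecurrentSum K ∅ +
          ecurrentSum K ({w} ∆ {v}) *
            ∑ s ∈ univ.filter (fun s => dist w s = (N₄ + 1 : ℕ)), ∑ z ∈ univ.filter (fun z => dist w z = R),
              ecurrentSum K ({s} ∆ {z}) ^ 2) * ecurrentSum K ({v} ∆ {y}) +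
      ecurrentSum K ({w} ∆ {v}) *
        ((∑ u ∈ univ.filter (fun u => dist w u = r), ecurrentSum K ({v} ∆ {u}) * ecurrentSum K ({u} ∆ {y})) *
            ecurrentSum K ∅ +
          ecurrentSum K ({v} ∆ {y}) *
            ∑ s ∈ univ.filter (fun s => dist w s = n₀), ∑ z ∈ univ.filter (fun z => dist w z = r),
              ecurrentSum K ({s} ∆ {z}) ^ 2) := by
  choose dn hdn using hint
  have hint' : ∀ a, ∃ k : ℕ, dist w a = k := fun a => ⟨dn a, hdn a⟩
  -- the nested balls
  set P : ℕ → Finset V := fun ρ => univ.filter fun z => dist w z ≤ ρ with hP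
  have hPmono : ∀ {ρ ρ' : ℕ}, ρ ≤ ρ' → P ρ ⊆ P ρ' := fun h z hz => by
    rw [hP, mem_filter] at hz ⊢; exact ⟨mem_univ _, hz.2.trans (by exact_mod_cast h)⟩
  have hmemP : ∀ {ρ : ℕ} {z : V}, z ∈ P ρ ↔ dist w z ≤ ρ := fun {ρ z} => by rw [hP, mem_filter]; simp
  have hw3 : w ∈ P M₃ := hmemP.2 (by rw [dist_self]; positivity)
  have hv3 : v ∈ P M₃ := hmemP.2 hvM
  have hy4 : y ∉ P N₄ := fun h => not_lt.2 (hmemP.1 h) hy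
  have hEin' : ∀ e ∈ Ein, ∀ z ∈ (e : Sym2 V), z ∈ P n₀ := fun e he z hz => hmemP.2 (hEin e he z hz)
  have hEout' : ∀ e ∈ Eout, ∃ z ∈ (e : Sym2 V), z ∉ P N₄ := fun e he => by
    obtain ⟨z, hz, hzN⟩ := hEout e he
    exact ⟨z, hz, fun h => not_lt.2 (hmemP.1 h) hzN⟩
  have h := tsum_epairWeight_splitFail_le (K := K) (hPmono h12) (hPmono h23) (hPmono h34) hw3 hv3 hy4 hEin' hEout'
  -- weaken the two crossing events to sphere-level events
  have hout : (∑' n : Current G, (if n.sources = {w} ∆ {v} then n.eweight K else 0) *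
        (if ∃ s, s ∉ P N₄ ∧ ∃ t ∈ P M₃, t ∈ n.cluster s then 1 else 0)) ≤
      ∑' n : Current G, (if n.sources = {w} ∆ {v} then n.eweight K else 0) *
        (if ∃ s, ((N₄ + 1 : ℕ) : ℝ) ≤ dist w s ∧ ∃ t, dist w t ≤ M₃ ∧ t ∈ n.cluster s then 1 else 0) := by
    refine ENNReal.tsum_le_tsum fun n => mul_le_mul' le_rfl ?_
    split_ifs with h1 h2
    · exact le_rfl
    · exfalso; apply h2
      obtain ⟨s, hs, t, ht, htc⟩ := h1
      refine ⟨s, ?_, t, hmemP.1 ht, htc⟩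
      have hs' : ¬ dist w s ≤ N₄ := fun h' => hs (hmemP.2 h')
      rw [hdn] at hs' ⊢
      push_cast
      exact_mod_cast (show N₄ + 1 ≤ dn s by
        have : ¬ (dn s : ℝ) ≤ (N₄ : ℝ) := hs'
        have : N₄ < dn s := by by_contra hc; push Not at hc; exact this (by exact_mod_cast hc)
        omega)
    · exact zero_le
    · exact le_rfl
  have hin : (∑' n : Current G, (if n.sources = {v} ∆ {y} then n.eweight K else 0) *
        (if ∃ s, s ∉ P m₀ ∧ ∃ t ∈ P n₀, t ∈ n.cluster s then 1 else 0)) ≤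
      ∑' n : Current G, (if n.sources = {v} ∆ {y} then n.eweight K else 0) *
        (if ∃ s, (r : ℝ) ≤ dist w s ∧ ∃ t, dist w t ≤ n₀ ∧ t ∈ n.cluster s then 1 else 0) := by
    refine ENNReal.tsum_le_tsum fun n => mul_le_mul' le_rfl ?_
    split_ifs with h1 h2
    · exact le_rfl
    · exfalso; apply h2
      obtain ⟨s, hs, t, ht, htc⟩ := h1
      refine ⟨s, ?_, t, hmemP.1 ht, htc⟩
      have hs' : ¬ dist w s ≤ m₀ := fun h' => hs (hmemP.2 h')
      rw [hdn] at hs' ⊢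
      exact_mod_cast (show r ≤ dn s by
        have : ¬ (dn s : ℝ) ≤ (m₀ : ℝ) := hs'
        have : m₀ < dn s := by by_contra hc; push Not at hc; exact this (by exact_mod_cast hc)
        omega)
    · exact zero_le
    · exact le_rfl
  -- the two crossing bounds
  have hO := tsum_crossOut_mul_sq_le hK hrk hstep hint' hMR hRN v (show dist w w ≤ (M₃ : ℝ) by
    rw [dist_self]; positivity)
  have hI := tsum_crossIn_mul_sq_le hK hrk hstep hint' hn₀r y hrv
  -- assemble
  calc (∑' p : Current G × Current G, epairWeight K ({w} ∆ {v}) ({v} ∆ {y}) p *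
        (if SplitEvent Ein Eout v y (p.1 + p.2) then 0 else 1)) * ecurrentSum K ∅ ^ 2
      ≤ ((∑' n : Current G, (if n.sources = {w} ∆ {v} then n.eweight K else 0) *
            (if ∃ s, s ∉ P N₄ ∧ ∃ t ∈ P M₃, t ∈ n.cluster s then 1 else 0)) * ecurrentSum K ({v} ∆ {y}) +
          ecurrentSum K ({w} ∆ {v}) * ∑' n : Current G, (if n.sources = {v} ∆ {y} then n.eweight K else 0) *
            (if ∃ s, s ∉ P m₀ ∧ ∃ t ∈ P n₀, t ∈ n.cluster s then 1 else 0)) * ecurrentSum K ∅ ^ 2 :=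
        mul_le_mul' h le_rfl
    _ ≤ ((∑' n : Current G, (if n.sources = {w} ∆ {v} then n.eweight K else 0) *
            (if ∃ s, ((N₄ + 1 : ℕ) : ℝ) ≤ dist w s ∧ ∃ t, dist w t ≤ M₃ ∧ t ∈ n.cluster s then 1 else 0)) *
            ecurrentSum K ({v} ∆ {y}) +
          ecurrentSum K ({w} ∆ {v}) * ∑' n : Current G, (if n.sources = {v} ∆ {y} then n.eweight K else 0) *
            (if ∃ s, (r : ℝ) ≤ dist w s ∧ ∃ t, dist w t ≤ n₀ ∧ t ∈ n.cluster s then 1 else 0)) * ecurrentSum K ∅ ^ 2 := by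
        gcongr
    _ = ((∑' n : Current G, (if n.sources = {w} ∆ {v} then n.eweight K else 0) *
            (if ∃ s, ((N₄ + 1 : ℕ) : ℝ) ≤ dist w s ∧ ∃ t, dist w t ≤ M₃ ∧ t ∈ n.cluster s then 1 else 0)) *
            ecurrentSum K ∅ ^ 2) * ecurrentSum K ({v} ∆ {y}) +
          ecurrentSum K ({w} ∆ {v}) * ((∑' n : Current G, (if n.sources = {v} ∆ {y} then n.eweight K else 0) *
            (if ∃ s, (r : ℝ) ≤ dist w s ∧ ∃ t, dist w t ≤ n₀ ∧ t ∈ n.cluster s then 1 else 0)) * ecurrentSum K ∅ ^ 2) := by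
        ring
    _ ≤ _ := add_le_add (mul_le_mul' hO le_rfl) (mul_le_mul' le_rfl hI)

/-! ### One sourceless pair -/

open Classical in
/-- **Lemma 6.7 for one sourceless pair** ("the case `t < i ≤ s` being even simpler since there are no
sources"): with radii `n₀ ≤ m₀ ≤ M₃ ≤ N₄`,
`∑ 1{∂n=∅}1{∂n'=∅} w w 𝟙[¬G(n+n')] ≤ ∑_{S_{N₄+1}×S_{M₃}} Z[sz]² + ∑_{S_{m₀+1}×S_{n₀}} Z[sz]²`.
[cite: AizenmanDuminilCopinAnnals2021, arXiv:1912.07973 §6.2, proof of Lemma 6.7 (p. 25)] -/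
theorem sourcelessPair_splitFail_le (hK : ∀ e, 0 ≤ K e)
    (hstep : ∀ a b, G.Adj a b → dist w b ≤ dist w a + 1) (hint : ∀ a, ∃ k : ℕ, dist w a = k)
    {n₀ m₀ M₃ N₄ : ℕ} (h12 : n₀ ≤ m₀) (h23 : m₀ ≤ M₃) (h34 : M₃ ≤ N₄) {Ein Eout : Finset G.edgeFinset}
    (hEin : ∀ e ∈ Ein, ∀ z ∈ (e : Sym2 V), dist w z ≤ n₀) (hEout : ∀ e ∈ Eout, ∃ z ∈ (e : Sym2 V), (N₄ : ℝ) < dist w z) :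
    ∑' p : Current G × Current G, epairWeight K ∅ ∅ p * (if SplitEvent Ein Eout w w (p.1 + p.2) then 0 else 1) ≤
      ∑ s ∈ univ.filter (fun s => dist w s = (N₄ + 1 : ℕ)), ∑ z ∈ univ.filter (fun z => dist w z = M₃),
          ecurrentSum K ({s} ∆ {z}) ^ 2 +
        ∑ s ∈ univ.filter (fun s => dist w s = (m₀ + 1 : ℕ)), ∑ z ∈ univ.filter (fun z => dist w z = n₀),
          ecurrentSum K ({s} ∆ {z}) ^ 2 := by
  choose dn hdn using hint
  have hint' : ∀ a, ∃ k : ℕ, dist w a = k := fun a => ⟨dn a, hdn a⟩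
  have hZ0 : ecurrentSum K (∅ : Finset V) ≠ 0 := ecurrentSum_empty_ne_zero K
  have hZtop : ecurrentSum K (∅ : Finset V) ≠ ∞ := ecurrentSum_ne_top hK ∅
  set P : ℕ → Finset V := fun ρ => univ.filter fun z => dist w z ≤ ρ with hP
  have hPmono : ∀ {ρ ρ' : ℕ}, ρ ≤ ρ' → P ρ ⊆ P ρ' := fun h z hz => by
    rw [hP, mem_filter] at hz ⊢; exact ⟨mem_univ _, hz.2.trans (by exact_mod_cast h)⟩
  have hmemP : ∀ {ρ : ℕ} {z : V}, z ∈ P ρ ↔ dist w z ≤ ρ := fun {ρ z} => by rw [hP, mem_filter]; simp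
  have hEin' : ∀ e ∈ Ein, ∀ z ∈ (e : Sym2 V), z ∈ P n₀ := fun e he z hz => hmemP.2 (hEin e he z hz)
  have hEout' : ∀ e ∈ Eout, ∃ z ∈ (e : Sym2 V), z ∉ P N₄ := fun e he => by
    obtain ⟨z, hz, hzN⟩ := hEout e he
    exact ⟨z, hz, fun h => not_lt.2 (hmemP.1 h) hzN⟩
  have h := tsum_epairWeight_splitFail_sourceless_le (K := K) (hPmono h12) (hPmono h23) (hPmono h34) w hEin' hEout'
  -- sphere-level events
  have hweak : ∀ (a b : ℕ), (∑' n : Current G, (if n.sources = ∅ then n.eweight K else 0) *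
        (if ∃ s, s ∉ P b ∧ ∃ t ∈ P a, t ∈ n.cluster s then 1 else 0)) ≤
      ∑' n : Current G, (if n.sources = ∅ then n.eweight K else 0) *
        (if ∃ s, ((b + 1 : ℕ) : ℝ) ≤ dist w s ∧ ∃ t, dist w t ≤ a ∧ t ∈ n.cluster s then 1 else 0) := by
    intro a b
    refine ENNReal.tsum_le_tsum fun n => mul_le_mul' le_rfl ?_
    split_ifs with h1 h2
    · exact le_rfl
    · exfalso; apply h2
      obtain ⟨s, hs, t, ht, htc⟩ := h1
      refine ⟨s, ?_, t, hmemP.1 ht, htc⟩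
      have hs' : ¬ dist w s ≤ b := fun h' => hs (hmemP.2 h')
      rw [hdn] at hs' ⊢
      push_cast
      exact_mod_cast (show b + 1 ≤ dn s by
        have : ¬ (dn s : ℝ) ≤ (b : ℝ) := hs'
        have : b < dn s := by by_contra hc; push Not at hc; exact this (by exact_mod_cast hc)
        omega)
    · exact zero_le
    · exact le_rfl
  have hO := tsum_sourceless_cross_mul_le hK hstep hint' (M := M₃) (N' := N₄ + 1) (by omega)
  have hI := tsum_sourceless_cross_mul_le hK hstep hint' (M := n₀) (N' := m₀ + 1) (by omega)
  -- `X ≤ A Z + Z B` with `A' Z ≤ ΣΣ`, `B' Z ≤ ΣΣ'`: multiply by `Z` and cancel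
  have hmul : (∑' p : Current G × Current G, epairWeight K ∅ ∅ p * (if SplitEvent Ein Eout w w (p.1 + p.2) then 0 else 1)) *
      ecurrentSum K ∅ ≤
      (∑ s ∈ univ.filter (fun s => dist w s = (N₄ + 1 : ℕ)), ∑ z ∈ univ.filter (fun z => dist w z = M₃),
          ecurrentSum K ({s} ∆ {z}) ^ 2 +
        ∑ s ∈ univ.filter (fun s => dist w s = (m₀ + 1 : ℕ)), ∑ z ∈ univ.filter (fun z => dist w z = n₀),
          ecurrentSum K ({s} ∆ {z}) ^ 2) * ecurrentSum K ∅ := by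
    calc _ ≤ ((∑' n : Current G, (if n.sources = ∅ then n.eweight K else 0) *
              (if ∃ s, s ∉ P N₄ ∧ ∃ t ∈ P M₃, t ∈ n.cluster s then 1 else 0)) * ecurrentSum K ∅ +
            ecurrentSum K ∅ * ∑' n : Current G, (if n.sources = ∅ then n.eweight K else 0) *
              (if ∃ s, s ∉ P m₀ ∧ ∃ t ∈ P n₀, t ∈ n.cluster s then 1 else 0)) * ecurrentSum K ∅ :=
          mul_le_mul' h le_rfl
      _ ≤ ((∑' n : Current G, (if n.sources = ∅ then n.eweight K else 0) *
              (if ∃ s, ((N₄ + 1 : ℕ) : ℝ) ≤ dist w s ∧ ∃ t, dist w t ≤ M₃ ∧ t ∈ n.cluster s then 1 else 0)) *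
              ecurrentSum K ∅ +
            ecurrentSum K ∅ * ∑' n : Current G, (if n.sources = ∅ then n.eweight K else 0) *
              (if ∃ s, ((m₀ + 1 : ℕ) : ℝ) ≤ dist w s ∧ ∃ t, dist w t ≤ n₀ ∧ t ∈ n.cluster s then 1 else 0)) *
              ecurrentSum K ∅ :=
          mul_le_mul' (add_le_add (mul_le_mul' (hweak M₃ N₄) le_rfl) (mul_le_mul' le_rfl (hweak n₀ m₀))) le_rfl
      _ = ((∑' n : Current G, (if n.sources = ∅ then n.eweight K else 0) *
              (if ∃ s, ((N₄ + 1 : ℕ) : ℝ) ≤ dist w s ∧ ∃ t, dist w t ≤ M₃ ∧ t ∈ n.cluster s then 1 else 0)) *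
              ecurrentSum K ∅) * ecurrentSum K ∅ +
            ((∑' n : Current G, (if n.sources = ∅ then n.eweight K else 0) *
              (if ∃ s, ((m₀ + 1 : ℕ) : ℝ) ≤ dist w s ∧ ∃ t, dist w t ≤ n₀ ∧ t ∈ n.cluster s then 1 else 0)) *
              ecurrentSum K ∅) * ecurrentSum K ∅ := by ring
      _ ≤ _ := by rw [add_mul]; exact add_le_add (mul_le_mul' hO le_rfl) (mul_le_mul' hI le_rfl)
  exact (ENNReal.mul_le_mul_iff_left hZ0 hZtop).1 hmul

/-! ### The hypothesis `hG` of the mixing core -/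

/-- Division bookkeeping: from `L · Q ≤ X` to `L ≤ (X/(P·Q)) · P` in `ℝ≥0∞` (`P, Q` finite and non-zero). [folklore] -/
theorem le_div_mul_of_mul_le {L X P Q : ℝ≥0∞} (hP0 : P ≠ 0) (hPt : P ≠ ∞) (hQ0 : Q ≠ 0) (hQt : Q ≠ ∞)
    (h : L * Q ≤ X) : L ≤ X / (P * Q) * P := by
  calc L ≤ X / Q := (ENNReal.le_div_iff_mul_le (Or.inl hQ0) (Or.inl hQt)).2 h
    _ = X / (P * Q) * P := by
        rw [div_eq_mul_inv, div_eq_mul_inv, ENNReal.mul_inv (Or.inl hP0) (Or.inl hPt),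
          show X * (P⁻¹ * Q⁻¹) * P = X * Q⁻¹ * (P⁻¹ * P) by ring, ENNReal.inv_mul_cancel hP0 hPt, mul_one]

open Classical in
/-- **Lemma 6.7 ⇒ the hypothesis `hG` of `Current.mixingCore` (centre sources `x₁ = x₂ = w`).** Under the
hypotheses of `sourcedPair_splitFail_mul_sq_le` for the two sourced pairs `(w,vᵢ),(vᵢ,yᵢ)` (non-vanishing pair
masses) and of `sourcelessPair_splitFail_le` for the two sourceless ones,
`∑_ω W_sw(ω) 𝟙[G(v)ᶜ] ≤ ε_G ∑_ω W_sw(ω)` with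
`ε_G = 2 (offOut₀ + offIn₀)/Z[∅]² + ∑ᵢ Xᵢ/(Z[wvᵢ]Z[vᵢyᵢ]Z[∅]²)`, `Xᵢ` the right-hand side of
`sourcedPair_splitFail_mul_sq_le` (union bound over the four pairs, `tsum_octoWeightSw_mul_splitFailInd_le`).
[cite: AizenmanDuminilCopinAnnals2021, arXiv:1912.07973 §6.2, Lemma 6.7 (p. 24) and its proof (p. 25)] -/
theorem splitFail_hG (hK : ∀ e, 0 ≤ K e) (hrk : Function.Injective rk)
    (hstep : ∀ a b, G.Adj a b → dist w b ≤ dist w a + 1) (hint : ∀ a, ∃ k : ℕ, dist w a = k)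
    {n₀ r m₀ M₃ R N₄ : ℕ} (hn₀r : n₀ ≤ r) (hrm : r ≤ m₀ + 1) (h12 : n₀ ≤ m₀) (h23 : m₀ ≤ M₃) (h34 : M₃ ≤ N₄)
    (hMR : M₃ < R) (hRN : R ≤ N₄ + 1) {v₁ v₂ y₁ y₂ : V}
    (hrv₁ : (r : ℝ) < dist w v₁) (hv₁M : dist w v₁ ≤ M₃) (hrv₂ : (r : ℝ) < dist w v₂) (hv₂M : dist w v₂ ≤ M₃)
    (hy₁ : (N₄ : ℝ) < dist w y₁) (hy₂ : (N₄ : ℝ) < dist w y₂)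
    (hZ₁ : ecurrentSum K ({w} ∆ {v₁}) * ecurrentSum K ({v₁} ∆ {y₁}) ≠ 0)
    (hZ₂ : ecurrentSum K ({w} ∆ {v₂}) * ecurrentSum K ({v₂} ∆ {y₂}) ≠ 0)
    {Ein Eout : Finset G.edgeFinset}
    (hEin : ∀ e ∈ Ein, ∀ z ∈ (e : Sym2 V), dist w z ≤ n₀) (hEout : ∀ e ∈ Eout, ∃ z ∈ (e : Sym2 V), (N₄ : ℝ) < dist w z) :
    ∑' ω : OctoCfg G, octoWeightSw K w w w y₁ y₂ v₁ v₂ ω * splitFailInd Ein Eout (octoU w v₁ v₂) (octoY w y₁ y₂) ω ≤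
      (2 * ((∑ s ∈ univ.filter (fun s => dist w s = (N₄ + 1 : ℕ)), ∑ z ∈ univ.filter (fun z => dist w z = M₃),
              ecurrentSum K ({s} ∆ {z}) ^ 2 +
            ∑ s ∈ univ.filter (fun s => dist w s = (m₀ + 1 : ℕ)), ∑ z ∈ univ.filter (fun z => dist w z = n₀),
              ecurrentSum K ({s} ∆ {z}) ^ 2) / ecurrentSum K ∅ ^ 2) +
        (((∑ u ∈ univ.filter (fun u => dist w u = R), ecurrentSum K ({w} ∆ {u}) * ecurrentSum K ({u} ∆ {v₁})) *
              ecurrentSum K ∅ +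
            ecurrentSum K ({w} ∆ {v₁}) *
              ∑ s ∈ univ.filter (fun s => dist w s = (N₄ + 1 : ℕ)), ∑ z ∈ univ.filter (fun z => dist w z = R),
                ecurrentSum K ({s} ∆ {z}) ^ 2) * ecurrentSum K ({v₁} ∆ {y₁}) +
          ecurrentSum K ({w} ∆ {v₁}) *
            ((∑ u ∈ univ.filter (fun u => dist w u = r), ecurrentSum K ({v₁} ∆ {u}) * ecurrentSum K ({u} ∆ {y₁})) *
                ecurrentSum K ∅ +
              ecurrentSum K ({v₁} ∆ {y₁}) *
                ∑ s ∈ univ.filter (fun s => dist w s = n₀), ∑ z ∈ univ.filter (fun z => dist w z = r),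
                  ecurrentSum K ({s} ∆ {z}) ^ 2)) /
          (ecurrentSum K ({w} ∆ {v₁}) * ecurrentSum K ({v₁} ∆ {y₁}) * ecurrentSum K ∅ ^ 2) +
        (((∑ u ∈ univ.filter (fun u => dist w u = R), ecurrentSum K ({w} ∆ {u}) * ecurrentSum K ({u} ∆ {v₂})) *
              ecurrentSum K ∅ +
            ecurrentSum K ({w} ∆ {v₂}) *
              ∑ s ∈ univ.filter (fun s => dist w s = (N₄ + 1 : ℕ)), ∑ z ∈ univ.filter (fun z => dist w z = R),
                ecurrentSum K ({s} ∆ {z}) ^ 2) * ecurrentSum K ({v₂} ∆ {y₂}) +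
          ecurrentSum K ({w} ∆ {v₂}) *
            ((∑ u ∈ univ.filter (fun u => dist w u = r), ecurrentSum K ({v₂} ∆ {u}) * ecurrentSum K ({u} ∆ {y₂})) *
                ecurrentSum K ∅ +
              ecurrentSum K ({v₂} ∆ {y₂}) *
                ∑ s ∈ univ.filter (fun s => dist w s = n₀), ∑ z ∈ univ.filter (fun z => dist w z = r),
                  ecurrentSum K ({s} ∆ {z}) ^ 2)) /
          (ecurrentSum K ({w} ∆ {v₂}) * ecurrentSum K ({v₂} ∆ {y₂}) * ecurrentSum K ∅ ^ 2)) *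
      ∑' ω : OctoCfg G, octoWeightSw K w w w y₁ y₂ v₁ v₂ ω := by
  have hZtop : ∀ A, ecurrentSum K A ≠ ∞ := fun A => ecurrentSum_ne_top hK A
  have hZ0 : ecurrentSum K (∅ : Finset V) ≠ 0 := ecurrentSum_empty_ne_zero K
  have hQ0 : ecurrentSum K (∅ : Finset V) ^ 2 ≠ 0 := pow_ne_zero 2 hZ0
  have hQt : ecurrentSum K (∅ : Finset V) ^ 2 ≠ ∞ := ENNReal.pow_ne_top (hZtop ∅)
  -- names for the four bounds
  set O₀ : ℝ≥0∞ := ∑ s ∈ univ.filter (fun s => dist w s = (N₄ + 1 : ℕ)), ∑ z ∈ univ.filter (fun z => dist w z = M₃),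
      ecurrentSum K ({s} ∆ {z}) ^ 2 +
    ∑ s ∈ univ.filter (fun s => dist w s = (m₀ + 1 : ℕ)), ∑ z ∈ univ.filter (fun z => dist w z = n₀),
      ecurrentSum K ({s} ∆ {z}) ^ 2 with hO₀
  set X : V → V → ℝ≥0∞ := fun v y =>
    ((∑ u ∈ univ.filter (fun u => dist w u = R), ecurrentSum K ({w} ∆ {u}) * ecurrentSum K ({u} ∆ {v})) *
          ecurrentSum K ∅ +
        ecurrentSum K ({w} ∆ {v}) *
          ∑ s ∈ univ.filter (fun s => dist w s = (N₄ + 1 : ℕ)), ∑ z ∈ univ.filter (fun z => dist w z = R),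
            ecurrentSum K ({s} ∆ {z}) ^ 2) * ecurrentSum K ({v} ∆ {y}) +
      ecurrentSum K ({w} ∆ {v}) *
        ((∑ u ∈ univ.filter (fun u => dist w u = r), ecurrentSum K ({v} ∆ {u}) * ecurrentSum K ({u} ∆ {y})) *
            ecurrentSum K ∅ +
          ecurrentSum K ({v} ∆ {y}) *
            ∑ s ∈ univ.filter (fun s => dist w s = n₀), ∑ z ∈ univ.filter (fun z => dist w z = r),
              ecurrentSum K ({s} ∆ {z}) ^ 2) with hX
  set ε₀ : ℝ≥0∞ := O₀ / ecurrentSum K ∅ ^ 2 with hε₀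
  set εs : V → V → ℝ≥0∞ := fun v y =>
    X v y / (ecurrentSum K ({w} ∆ {v}) * ecurrentSum K ({v} ∆ {y}) * ecurrentSum K ∅ ^ 2) with hεs
  set ε : Fin 4 → ℝ≥0∞ := ![ε₀, εs v₁ y₁, ε₀, εs v₂ y₂] with hε
  -- the per-pair bounds
  have hsl : ∑' p : Current G × Current G, epairWeight K ∅ ∅ p * (if SplitEvent Ein Eout w w (p.1 + p.2) then 0 else 1) ≤
      ε₀ * ∑' p : Current G × Current G, epairWeight K ∅ ∅ p := by
    rw [tsum_epairWeight, ← sq, hε₀, ENNReal.div_mul_cancel hQ0 hQt]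
    exact sourcelessPair_splitFail_le hK hstep hint h12 h23 h34 hEin hEout
  have hsrc : ∀ {v y : V}, (r : ℝ) < dist w v → dist w v ≤ M₃ → (N₄ : ℝ) < dist w y →
      ecurrentSum K ({w} ∆ {v}) * ecurrentSum K ({v} ∆ {y}) ≠ 0 →
      ∑' p : Current G × Current G, epairWeight K ({w} ∆ {v}) ({v} ∆ {y}) p *
          (if SplitEvent Ein Eout v y (p.1 + p.2) then 0 else 1) ≤
        εs v y * ∑' p : Current G × Current G, epairWeight K ({w} ∆ {v}) ({v} ∆ {y}) p := by
    intro v y hrv hvM hy hZ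
    rw [tsum_epairWeight, hεs]
    exact le_div_mul_of_mul_le hZ (ENNReal.mul_ne_top (hZtop _) (hZtop _)) hQ0 hQt
      (sourcedPair_splitFail_mul_sq_le hK hrk hstep hint hn₀r hrm h12 h23 h34 hMR hRN hrv hvM hy hEin hEout)
  have h := tsum_octoWeightSw_mul_splitFailInd_le K Ein Eout w w w y₁ y₂ v₁ v₂ ε (fun i => by
    fin_cases i
    · simpa [hε, octoX, octoU, octoY] using hsl
    · simpa [hε, octoX, octoU, octoY] using hsrc hrv₁ hv₁M hy₁ hZ₁
    · simpa [hε, octoX, octoU, octoY] using hsl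
    · simpa [hε, octoX, octoU, octoY] using hsrc hrv₂ hv₂M hy₂ hZ₂)
  refine h.trans (le_of_eq ?_)
  congr 1
  rw [hε, Fin.sum_univ_four]
  simp only [Matrix.cons_val_zero, Matrix.cons_val_one, Matrix.cons_val]
  rw [hε₀, hεs, hX, hO₀]
  ring

end Current

end Literature.Probability.LatticeModels
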